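import Summits.BirchSwinnertonDyer.BirchSwinnertonDyer.Theorems.PrintX11aUpperNonSurjFiveCartanDescentProjection
import Summits.BirchSwinnertonDyer.BirchSwinnertonDyer.Theorems.PrintX11aUpperNonSurjFiveCartanLocalMult
import Literature.NumberTheory.GaloisRepresentations.DegreeOnePlacesProofs

/-!
# Line «gl1cartan5» of crux U5 `Theses.PrintX11a.UpperNonSurjFive` — stub D (Cartan descent), part 2/3: the local conditions at `p`-adic
# and generic places

With `π_*` from part 1 (`…CartanDescentProjection.lean`): (§5a) above the split prime `p`, inertia at `𝔭'` fixes `M` but acts on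
`E_K[p]` through the cyclotomic character with a value `−1` (`exists_mem_inertia_smul_ne`), so any inertia-trivialising line `X` of
order `≤ p` is the complement `L'` (`le_of_tateLine`); (§5b) STRICT at `𝔭'`: `E_K` is multiplicative at `𝔭'`, local Kummer classes are
valued in the Tate line of D-L (`stub_cartanLocalMult`, p653824), hence `loc_𝔭'(π_* s) = 0` for every Selmer class `s`; (§5c) at
`w ∤ p`: the primes of `K` containing `p` are exactly `𝔭, 𝔭'`, and two vanishing / unramifiedness criteria for `loc_w(π_* s)`.
Part 3/3 dispatches on the reduction type below `w` and assembles `stub_cartanDescent`.  Lead `cruxlead-stmt-BirchSwinnertonDyer-20614` g0.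

BSD is not proved by any of this; nothing is asserted about any particular curve; no statement of the summit is proved here.

References: [MazurRubin2004] Def. 2.1.1; [Serre1972] §1.12, §2.8; [SerreGaloisCohomology1997] I.§2, I.§5; [SilvermanAEC2009] X.4.2,
Cor. X.4.4, VII.6; [SilvermanATAEC1994] V.3.1, V.5.2–5.4; [GrossLMS1991] §5 (5.1); [MilneADT2006] I.3.8.
-/


-- justified: the file namespace `Summit.BirchSwinnertonDyer.BirchSwinnertonDyer.Theorems.GL1Cartan` repeats the sub-problem segment by the D-0017 layout
set_option linter.dupNamespace false
set_option autoImplicit false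

noncomputable section

open scoped Classical NumberField ContRepresentation

open WeierstrassCurve Field IsDedekindDomain NumberField
  Literature.NumberTheory.EllipticCurves
  Literature.NumberTheory.EllipticCurves.Rank1Residual
  Literature.NumberTheory.EllipticCurves.Rank1Residual.Typed
  Literature.NumberTheory.GaloisRepresentations
  Literature.NumberTheory.GaloisRepresentations.DiscreteGaloisModule
  Literature.NumberTheory.SerreUniformity
  Summit.BirchSwinnertonDyer.Rank1Residual

namespace Summit.BirchSwinnertonDyer.BirchSwinnertonDyer.Theorems.GL1Cartan


/-! ## §5 The local conditions -/

/-! ### §5a At `𝔭'`: the Tate line is `L'`, so `π_*` kills the local class (STRICT) -/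

section AtPPrime

variable {W : WeierstrassCurve ℚ} [W.IsElliptic] {p : ℕ} [Fact p.Prime] (𝒟 : CartanDatum W p)

namespace CartanDatum

/-- **The inertia group at `𝔭'` moves `E_K[p]`** (`p` odd): above the split prime `p` of the quadratic field
`K` there is `τ ∈ I_𝔭'` with `χ_p(τ) = −1` (`exists_mem_inertia_cyclotomicCharacter_eq_of_split`); if `τ` fixed
`E_K[p]` pointwise it would fix `μ_p` (Weil pairing, `smul_eq_self_of_pow_eq_one_of_forall_smul_geomTorsion_eq`),
but `τ ζ = ζ^{p-1} ≠ ζ`. [cite: SilvermanAEC2009, Cor. III.8.1.1] [cite: NeukirchANT1999, Ch. II (7.13)] -/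
theorem exists_mem_inertia_smul_ne (hp2 : p ≠ 2) :
    ∃ τ ∈ GreenbergSelmer.inertia 𝒟.𝔭', ∃ P : (W.baseChange 𝒟.K).geomTorsion (p : ℤ), τ • P ≠ P := by
  have hp : p.Prime := Fact.out
  haveI : (W.baseChange 𝒟.K).IsElliptic := by rw [baseChange]; infer_instance
  -- an inertia element with cyclotomic character `-1`
  obtain ⟨τ, hτI, hτχ⟩ := ZpExtension.exists_mem_inertia_cyclotomicCharacter_eq_of_split 𝒟.finrank_eq_two
    (v := 𝒟.𝔭) (vbar := 𝒟.𝔭') 𝒟.mem 𝒟.mem' 𝒟.ne.symm (adicCompletionPrime_mem_primesAbove 𝒟.K 𝒟.𝔭') (-1)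
  rw [inertia_adicCompletionPrime_eq_map_absInertia] at hτI
  refine ⟨τ, hτI, ?_⟩
  by_contra hfix
  push Not at hfix
  -- a primitive `p`-th root of unity in `K̄`
  haveI : NeZero (p : AlgebraicClosure 𝒟.K) := ⟨by exact_mod_cast hp.ne_zero⟩
  obtain ⟨ζ, hζ⟩ := HasEnoughRootsOfUnity.exists_primitiveRoot (AlgebraicClosure 𝒟.K) p
  have hζp : ζ ^ p = 1 := hζ.pow_eq_one
  -- `τ` fixes `ζ` …
  have hfixζ : τ • ζ = ζ :=
    (W.baseChange 𝒟.K).smul_eq_self_of_pow_eq_one_of_forall_smul_geomTorsion_eq (ℓ := p)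
      (by exact_mod_cast hp.ne_zero) hfix hζp
  -- … but acts on it through `χ_p(τ) = -1`
  have hspec := GaloisRep.cyclotomicCharacter_spec (K := 𝒟.K) (ℓ := p) (k := 1) τ ζ (by rw [pow_one]; exact hζp)
  rw [hτχ, hfixζ] at hspec
  have hval : ((((-1 : ℤ_[p]ˣ) : ℤ_[p]).toZModPow 1).val : ℕ) = p ^ 1 - 1 := by
    haveI : NeZero (p ^ 1) := ⟨pow_ne_zero _ hp.ne_zero⟩
    haveI : Fact (1 < p ^ 1) := ⟨by rw [pow_one]; exact hp.one_lt⟩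
    rw [Units.val_neg, Units.val_one, map_neg, map_one, ZMod.val_neg_of_ne_zero, ZMod.val_one]
  rw [hval, pow_one] at hspec
  -- `ζ = ζ^(p-1)` contradicts primitivity (`p ≥ 3`)
  have h3 : 3 ≤ p := by
    have h2 := hp.two_le
    omega
  have hpow : ζ ^ (p - 2) = 1 := by
    have h1 : ζ ^ (p - 2) * ζ = ζ ^ (p - 1) := by
      rw [← pow_succ]; congr 1; omega
    rw [← hspec] at h1
    -- `ζ^(p-2) * ζ = ζ` with `ζ ≠ 0`
    have hζ0 : ζ ≠ 0 := hζ.ne_zero hp.ne_zero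
    calc ζ ^ (p - 2) = ζ ^ (p - 2) * ζ * ζ⁻¹ := by rw [mul_inv_cancel_right₀ hζ0]
      _ = ζ * ζ⁻¹ := by rw [h1]
      _ = 1 := mul_inv_cancel₀ hζ0
  have hdvd := hζ.dvd_of_pow_eq_one _ hpow
  have : p ≤ p - 2 := Nat.le_of_dvd (by omega) hdvd
  omega

/-- **The Tate line lies in (indeed equals) the complement `L'`.**  If `X ≤ E_K[p]` has `#X ≤ p`, inertia at
`𝔭'` moves everything into `X`, fixes `L = ι(M)` pointwise (the datum) and `L'` is `Γ_K`-stable, then `X ≤ L'`: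
otherwise `X ⊓ L' = ⊥`, so inertia would fix `L'` too, hence all of `E_K[p] = L ⊕ L'`. [folklore] -/
theorem le_of_tateLine (hp2 : p ≠ 2) {L' X : AddSubgroup ((W.baseChange 𝒟.K).geomTorsion (p : ℤ))}
    (hL'card : Nat.card L' = p) (hLL' : 𝒟.line ⊓ L' = ⊥)
    (hL'stab : ∀ (σ : absoluteGaloisGroup 𝒟.K) (P : (W.baseChange 𝒟.K).geomTorsion (p : ℤ)),
      P ∈ L' → σ • P ∈ L')
    (hXcard : Nat.card X ≤ p)
    (hXI : ∀ τ ∈ GreenbergSelmer.inertia 𝒟.𝔭', ∀ P : (W.baseChange 𝒟.K).geomTorsion (p : ℤ), τ • P - P ∈ X) :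
    X ≤ L' := by
  have hp : p.Prime := Fact.out
  by_contra hXL'
  have hG := natCard_geomTorsion_baseChange (W := W) (p := p) 𝒟.K
  haveI : Finite ((W.baseChange 𝒟.K).geomTorsion (p : ℤ)) :=
    Nat.finite_of_card_ne_zero (by rw [hG]; exact pow_ne_zero _ hp.ne_zero)
  -- `X ⊓ L' = ⊥`
  have hmeet : X ⊓ L' = ⊥ := by
    have hXdvd : Nat.card X ∣ p ^ 2 := by rw [← hG]; exact X.card_addSubgroup_dvd_card
    obtain ⟨k, hk, hXk⟩ := (Nat.dvd_prime_pow hp).mp hXdvd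
    have hk1 : k ≤ 1 := by
      by_contra hk1
      have hk2 : k = 2 := by omega
      rw [hk2] at hXk
      have h' : Nat.card X ≤ p := hXcard
      rw [hXk, sq] at h'
      have h'' : p * p ≤ p * 1 := by rw [mul_one]; exact h'
      have := Nat.le_of_mul_le_mul_left h'' hp.pos
      have := hp.one_lt
      omega
    rcases Nat.le_one_iff_eq_zero_or_eq_one.mp hk1 with rfl | rfl
    · rw [pow_zero] at hXk
      rw [AddSubgroup.eq_bot_of_card_eq X hXk, bot_inf_eq]
    · rw [pow_one] at hXk
      have hYdvd : Nat.card (X ⊓ L' : AddSubgroup _) ∣ Nat.card X :=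
        AddSubgroup.card_dvd_of_le inf_le_left
      rw [hXk] at hYdvd
      rcases (Nat.dvd_prime hp).mp hYdvd with h1 | hpY
      · exact AddSubgroup.eq_bot_of_card_eq _ h1
      · exfalso
        have hXeq : X ⊓ L' = X :=
          AddSubgroup.eq_of_le_of_card_ge inf_le_left (by rw [hpY, hXk])
        exact hXL' (hXeq.symm ▸ inf_le_right)
  -- then inertia acts trivially on everything: contradiction
  obtain ⟨τ, hτ, P, hP⟩ := 𝒟.exists_mem_inertia_smul_ne hp2
  apply hP
  obtain ⟨a, b, rfl⟩ := exists_eq_add (p := p) hG 𝒟.natCard_line hL'card hLL' P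
  have ha : τ • (a : (W.baseChange 𝒟.K).geomTorsion (p : ℤ)) = a := by
    obtain ⟨m, hm⟩ := a.2
    rw [← hm, ← 𝒟.equivariant, 𝒟.unramified τ hτ m]
  have hb : τ • (b : (W.baseChange 𝒟.K).geomTorsion (p : ℤ)) = b := by
    have h1 : τ • (b : (W.baseChange 𝒟.K).geomTorsion (p : ℤ)) - b ∈ X ⊓ L' :=
      ⟨hXI τ hτ b, L'.sub_mem (hL'stab τ b b.2) b.2⟩
    rw [hmeet] at h1
    exact sub_eq_zero.mp h1
  rw [smul_add, ha, hb]

end CartanDatum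

end AtPPrime

/-! ### §5b The STRICT condition at `𝔭'` -/

section Strict

variable {W : WeierstrassCurve ℚ} [W.IsElliptic] [W.IsGloballyMinimal] {p : ℕ} [Fact p.Prime]
  (𝒟 : CartanDatum W p)
  (L' : AddSubgroup ((W.baseChange 𝒟.K).geomTorsion (p : ℤ)))
  (hL'card : Nat.card L' = p) (hLL' : 𝒟.line ⊓ L' = ⊥)
  (hL'stab : ∀ (σ : absoluteGaloisGroup 𝒟.K) (P : (W.baseChange 𝒟.K).geomTorsion (p : ℤ)),
    P ∈ L' → σ • P ∈ L')

namespace CartanDatum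

/-- **STRICT at `𝔭'`.** For a Selmer class `s ∈ Sel_p(E_K/K)`, `loc_𝔭'(π_* s) = 0`: `E_K` is multiplicative at `𝔭'`
(`isMinimalAt_and_hasMultiplicativeReductionAt_baseChange_of_mult`), the local Kummer class is valued in the Tate
line `X` (`stub_cartanLocalMult`, D-L), `X ≤ L'` (`le_of_tateLine`) and `π` kills `L'`.
[cite: Serre1972, §1.12, Cor. of Prop. 13] [cite: MazurRubin2004, Def. 2.1.1] -/
theorem localization_𝔭'_projH1_eq_zero (hp2 : p ≠ 2)
    (hmult : W.HasMultiplicativeReductionAtPrime p)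
    (s : galH1Torsion (W.baseChange 𝒟.K) (p : ℤ))
    (hs : s ∈ selmerGroup (W.baseChange 𝒟.K) (p : ℤ)) :
    galoisCohomology.localization 𝒟.ρ (Sum.inr 𝒟.𝔭') 1 (𝒟.projH1 L' hL'card hLL' hL'stab s) = 0 := by
  haveI : (W.baseChange 𝒟.K).IsElliptic := by rw [baseChange]; infer_instance
  have hmultV : (W.baseChange 𝒟.K).HasMultiplicativeReductionAt 𝒟.𝔭' :=
    (Additive.isMinimalAt_and_hasMultiplicativeReductionAt_baseChange_of_mult W hmult 𝒟.𝔭' 𝒟.mem').2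
  obtain ⟨X, hXcard, hXI, hXval⟩ := stub_cartanLocalMult 𝒟.K (W.baseChange 𝒟.K) p 𝒟.𝔭' hp2 𝒟.mem' hmultV
  have hXL' : X ≤ L' := 𝒟.le_of_tateLine hp2 hL'card hLL' hL'stab hXcard hXI
  -- the local class at `𝔭'` is a Kummer class
  have hloc : galoisCohomology.localization ((W.baseChange 𝒟.K).torsionGaloisModule (p : ℤ))
      (Sum.inr 𝒟.𝔭') 1 s ∈ (W.baseChange 𝒟.K).kummerLocalConditionAt (p : ℤ) (𝒟.𝔭'.adicCompletion 𝒟.K) := by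
    have h := ((W.baseChange 𝒟.K).mem_selmerGroup_iff_forall_localization_mem (p : ℤ) s).mp hs
      (Sum.inr 𝒟.𝔭')
    rwa [WeierstrassCurve.kummerSelmerStructure_apply] at h
  obtain ⟨ψ, hψX, hψc⟩ := hXval _ hloc
  change galoisCohomology.res 𝒟.ρ (Place.Completion (Sum.inr 𝒟.𝔭' : Place 𝒟.K)) 1 _ = 0
  rw [res_projH1]
  change galoisCohomology.map _ 1
    (galoisCohomology.localization ((W.baseChange 𝒟.K).torsionGaloisModule (p : ℤ)) (Sum.inr 𝒟.𝔭') 1 s) = 0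
  rw [← hψc]
  exact 𝒟.map_restrictField_projI_oneCocycleClass_eq_zero L' hL'card hLL' hL'stab _ ψ
    (fun g => hXL' (hψX g))

end CartanDatum

end Strict

/-! ### §5c At `w ∤ p`: the local class of `π_* s` is UNRAMIFIED -/

section AwayFromP

variable {W : WeierstrassCurve ℚ} [W.IsElliptic] [W.IsGloballyMinimal] {p : ℕ} [Fact p.Prime]
  (𝒟 : CartanDatum W p)
  (L' : AddSubgroup ((W.baseChange 𝒟.K).geomTorsion (p : ℤ)))
  (hL'card : Nat.card L' = p) (hLL' : 𝒟.line ⊓ L' = ⊥)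
  (hL'stab : ∀ (σ : absoluteGaloisGroup 𝒟.K) (P : (W.baseChange 𝒟.K).geomTorsion (p : ℤ)),
    P ∈ L' → σ • P ∈ L')

namespace CartanDatum

omit [W.IsGloballyMinimal] in
/-- **The primes of `K` above `p` are `𝔭` and `𝔭'`** (`[K : ℚ] = 2`, `∑ e f = 2`). [cite: NeukirchANT1999, Ch. I §8 Prop. (8.2)] -/
theorem eq_or_eq_of_mem {w : HeightOneSpectrum (𝓞 𝒟.K)} (hw : ((p : ℕ) : 𝓞 𝒟.K) ∈ w.asIdeal) :
    w = 𝒟.𝔭 ∨ w = 𝒟.𝔭' := by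
  have hp : p.Prime := Fact.out
  by_contra h
  push Not at h
  obtain ⟨hw1, hw2⟩ := h
  have hcard := ZpExtension.ncard_primesOver_under_eq_finrank_of_ne (p := p) 𝒟.finrank_eq_two
    (v := 𝒟.𝔭) (vbar := 𝒟.𝔭') 𝒟.mem 𝒟.mem' 𝒟.ne.symm
  rw [𝒟.finrank_eq_two] at hcard
  set u := 𝒟.𝔭.under (𝓞 ℚ) with hu
  have memOf : ∀ {x : HeightOneSpectrum (𝓞 𝒟.K)}, ((p : ℕ) : 𝓞 𝒟.K) ∈ x.asIdeal →
      x.asIdeal ∈ u.asIdeal.primesOver (𝓞 𝒟.K) := by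
    intro x hx
    refine ⟨x.isPrime, ⟨?_⟩⟩
    rw [hu, HeightOneSpectrum.under_asIdeal]
    -- both `x` and `𝔭` lie over the prime of `ℚ` containing `p`
    have h1 : x.asIdeal.under (𝓞 ℚ) = (x.under (𝓞 ℚ)).asIdeal := (HeightOneSpectrum.under_asIdeal (𝓞 ℚ) x).symm
    have h2 : 𝒟.𝔭.asIdeal.under (𝓞 ℚ) = (𝒟.𝔭.under (𝓞 ℚ)).asIdeal := (HeightOneSpectrum.under_asIdeal (𝓞 ℚ) 𝒟.𝔭).symm
    rw [h1, h2]
    congr 1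
    -- a place containing `p` lies above the place `(p)` of `ℚ`, and that place is unique
    have hunder : ∀ {y : HeightOneSpectrum (𝓞 𝒟.K)}, ((p : ℕ) : 𝓞 𝒟.K) ∈ y.asIdeal →
        (p : 𝓞 ℚ) ∈ (y.under (𝓞 ℚ)).asIdeal := by
      intro y hy
      rw [HeightOneSpectrum.under_asIdeal, Ideal.under_def, Ideal.mem_comap, map_natCast]
      exact hy
    exact Literature.NumberTheory.GaloisRepresentations.Rat.eq_of_natCast_prime_mem hp (hunder 𝒟.mem) (hunder hx)
  have hfin : (u.asIdeal.primesOver (𝓞 𝒟.K)).Finite := Set.finite_of_ncard_ne_zero (by rw [hcard]; decide)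
  have h3 : ({w.asIdeal, 𝒟.𝔭.asIdeal, 𝒟.𝔭'.asIdeal} : Set (Ideal (𝓞 𝒟.K))) ⊆ u.asIdeal.primesOver (𝓞 𝒟.K) := by
    intro x hx
    rcases hx with rfl | rfl | rfl
    · exact memOf hw
    · exact memOf 𝒟.mem
    · exact memOf 𝒟.mem'
  have hne1 : w.asIdeal ≠ 𝒟.𝔭.asIdeal := fun h => hw1 (HeightOneSpectrum.ext h)
  have hne2 : w.asIdeal ≠ 𝒟.𝔭'.asIdeal := fun h => hw2 (HeightOneSpectrum.ext h)
  have hne3 : 𝒟.𝔭.asIdeal ≠ 𝒟.𝔭'.asIdeal := fun h => 𝒟.ne (HeightOneSpectrum.ext h)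
  have hthree : ({w.asIdeal, 𝒟.𝔭.asIdeal, 𝒟.𝔭'.asIdeal} : Set (Ideal (𝓞 𝒟.K))).ncard = 3 :=
    Set.ncard_eq_three.mpr ⟨_, _, _, hne1, hne2, hne3, rfl⟩
  have := Set.ncard_le_ncard h3 hfin
  rw [hthree, hcard] at this
  omega

omit [W.IsGloballyMinimal] in
/-- `w ∤ p` for `w ∉ {𝔭, 𝔭'}`. [folklore] -/
theorem not_mem_of_ne {w : HeightOneSpectrum (𝓞 𝒟.K)} (h1 : w ≠ 𝒟.𝔭) (h2 : w ≠ 𝒟.𝔭') :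
    ((p : ℕ) : 𝓞 𝒟.K) ∉ w.asIdeal := fun hw => by
  rcases 𝒟.eq_or_eq_of_mem hw with rfl | rfl
  · exact h1 rfl
  · exact h2 rfl

omit [W.IsGloballyMinimal] in
/-- **Unramified from an identification `𝓛_w = H¹_ur`**: if the Kummer local condition of `E_K[p]` at `w` IS the
unramified subgroup, then for `s ∈ Sel_p(E_K/K)` the class `loc_w(π_* s)` is unramified (`π_*` preserves `H¹_ur`,
`galoisCohomology.map_unramifiedSubgroup_le`). [cite: MilneADT2006, Ch. I Prop. 3.8] -/
theorem localization_projH1_mem_unramifiedSubgroup_of_eq (w : HeightOneSpectrum (𝓞 𝒟.K))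
    (heq : (W.baseChange 𝒟.K).kummerSelmerStructure (p : ℤ) (Sum.inr w) =
      unramifiedSubgroup (GaloisRep.toLocal w ((W.baseChange 𝒟.K).torsionGaloisModule (p : ℤ))) 1)
    (s : galH1Torsion (W.baseChange 𝒟.K) (p : ℤ))
    (hs : s ∈ selmerGroup (W.baseChange 𝒟.K) (p : ℤ)) :
    galoisCohomology.localization 𝒟.ρ (Sum.inr w) 1 (𝒟.projH1 L' hL'card hLL' hL'stab s) ∈
      unramifiedSubgroup (GaloisRep.toLocal w 𝒟.ρ) 1 := by
  haveI : (W.baseChange 𝒟.K).IsElliptic := by rw [baseChange]; infer_instance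
  have hloc := ((W.baseChange 𝒟.K).mem_selmerGroup_iff_forall_localization_mem (p : ℤ) s).mp hs (Sum.inr w)
  rw [heq] at hloc
  change galoisCohomology.res 𝒟.ρ (Place.Completion (Sum.inr w : Place 𝒟.K)) 1 _ ∈ _
  rw [res_projH1]
  exact galoisCohomology.map_unramifiedSubgroup_le _ ⟨_, hloc, rfl⟩

omit [W.IsGloballyMinimal] in
/-- **Local VANISHING from `E_K(K_w)[p] = 0`** at `w ∤ p`: then `H¹(K_w, E_K[p]) = 0`, so `loc_w(π_* s) = 0` for every
`s`. [cite: MilneADT2006, Ch. I Cor. 2.3 and Thm. 2.8] -/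
theorem localization_projH1_eq_zero_of_forall_nsmul_eq_zero (w : HeightOneSpectrum (𝓞 𝒟.K))
    (hpw : ((p : ℕ) : 𝓞 𝒟.K) ∉ w.asIdeal)
    (htors : ∀ P : ((W.baseChange 𝒟.K).baseChange (w.adicCompletion 𝒟.K)).toAffine.Point, p • P = 0 → P = 0)
    (s : galH1Torsion (W.baseChange 𝒟.K) (p : ℤ)) :
    galoisCohomology.localization 𝒟.ρ (Sum.inr w) 1 (𝒟.projH1 L' hL'card hLL' hL'stab s) = 0 := by
  haveI : (W.baseChange 𝒟.K).IsElliptic := by rw [baseChange]; infer_instance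
  haveI : NeZero p := ⟨(Fact.out : p.Prime).ne_zero⟩
  have hsub := subsingleton_galoisCohomology_one_torsion_adicCompletion_of_forall_nsmul_eq_zero
    (W.baseChange 𝒟.K) w p hpw htors
  change galoisCohomology.res 𝒟.ρ (Place.Completion (Sum.inr w : Place 𝒟.K)) 1 _ = 0
  rw [res_projH1]
  have h0 : galoisCohomology.res ((W.baseChange 𝒟.K).torsionGaloisModule (p : ℤ))
      (w.adicCompletion 𝒟.K) 1 s = 0 := @Subsingleton.elim _ hsub _ _
  change galoisCohomology.map _ 1 (galoisCohomology.res ((W.baseChange 𝒟.K).torsionGaloisModule (p : ℤ))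
      (w.adicCompletion 𝒟.K) 1 s) = 0
  rw [h0, map_zero]

end CartanDatum

end AwayFromP

end Summit.BirchSwinnertonDyer.BirchSwinnertonDyer.Theorems.GL1Cartan

end
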